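import Literature.AlgebraicGeometry.GroupSchemes.GroupSchemeActionStabilizerBaseChange
import Literature.AlgebraicGeometry.Limits.SurjectiveSpread
import Mathlib.AlgebraicGeometry.ZariskisMainTheorem
import HarnessLib

/-!
# Free and proper actions: base change, and the proper-monomorphism criterion (MFK Def. 0.8)

Mumford–Fogarty–Kirwan, *GIT*, Ch. 0 §3, Def. 0.8 (pp. 9–10): an action `σ` of `G/S` on `X/S` is
(iii) proper if `Ψ = (σ, p₂) : G ×_S X → X ×_S X` is proper, (iv) free if `Ψ` is a closed immersion;
Ch. 0 §4, proof of Prop. 0.9 (p. 16): "by such a base extension, i) `σ` remains free".  The tree has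
the notions (`shear G X = Ψ`, `IsProperAction`, `IsFreeAction`, `IsFreeAction.eq_one_of_smul_eq`,
`lift_comp_shear_injective_iff`; file `GroupSchemeActionProperFree`) and the base-changed action
`ActionBaseChange.actionObj F G X` (p762665, an `abbrev`, not an instance).  This file proves, with no
definition, no instance, no named fact:

* §1 **`Ψ` commutes with base change**: for a monoidal functor `F : Over S ⥤ Over S'` between slice
  categories and the transported action, `μ_F ≫ F(Ψ_{G,X}) = Ψ_{F G, F X} ≫ μ_F`
  (`ActionBaseChange.μ_comp_map_shear`), hence `Ψ_{F G, F X} = μ_F ≫ F(Ψ) ≫ μ_F⁻¹`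
  (`shear_obj_eq`) and, on underlying schemes, `P (Ψ_{F G,F X}) ↔ P (F Ψ)` for every morphism
  property `P` respecting isomorphisms (`shear_obj_left_iff`);
* §2 (**base change `g : S' ⟶ S`**, `F = Over.pullback g`): `(F Ψ).left` is a base change of `Ψ.left`
  (tree `Limits.isPullback_pullback_map_left`), so every `P` stable under base change passes from
  `Ψ_{G,X}` to `Ψ_{G ×_S S', X ×_S S'}` (`ActionBaseChange.shear_left_baseChange`); in particular
  **`IsProperAction.baseChange`** and **`IsFreeAction.baseChange`** (MFK (iii), (iv); (ii) "separated
  action" = closed set-image is NOT stable under base change and is not treated);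
* §3 **the proper-monomorphism criterion**: `Ψ` is a monomorphism of `S`-schemes iff all stabilisers
  of `T`-valued points are trivial (`mono_shear_iff_forall_eq_one`, Yoneda on the tree's
  `lift_comp_shear_injective_iff`), and a proper monomorphism is a closed immersion (Mathlib
  `IsClosedImmersion.iff_isProper_and_mono`, Stacks 04XV), whence
  **`isFreeAction_iff_isProperAction_and_forall_eq_one : IsFreeAction G X ↔ IsProperAction G X ∧
  ∀ T (a : T ⟶ G) (x : T ⟶ X), a • x = x → a = 1`** and `IsFreeAction.of_isProperAction`.

## References

* D. Mumford, J. Fogarty, F. Kirwan, *Geometric Invariant Theory*, 3rd ed., Springer (1994): Ch. 0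
  §3, Def. 0.8 (pp. 9–10); Ch. 0 §4, Prop. 0.9, proof (p. 16). [MumfordFogartyKirwan1994]
* The Stacks Project, Tag 04XV (a morphism is a closed immersion iff it is proper and a
  monomorphism). [StacksProject]

## Design notes

* Statements about the base-changed action name the action explicitly, `(σ := actionObj F G X)`
  (the binder of `shear`/`IsFreeAction`/`IsProperAction` is NAMED `σ` for this purpose), so the file
  declares no instance and no instance attribute; a consumer working under
  `letI := ActionBaseChange.actionObj F G X` sees literally the same terms.
* Consumers (cell hodgecm-mathlib, F-DAG capital): F-7 (7b)/(7c) (freeness/properness of the `GL`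
  action on `H`, moved along `T → S` for `classify`), F-8, the finite-flat loci wrappers.
* Mathlib / Literature searches: Mathlib has `Functor.Monoidal.lift_μ/μ_snd`,
  `MorphismProperty.of_isPullback`, `cancel_left/right_of_respectsIso`,
  `IsClosedImmersion.iff_isProper_and_mono`, `Over.mono_left_of_mono/mono_of_mono_left`; Literature has
  `shear`, `IsFreeAction`, `IsProperAction`, `lift_comp_shear(_injective_iff)`,
  `isPullback_pullback_map_left`, `ActionBaseChange.actionObj/smul_def`.  Nothing is restated.
-/

universe u

open CategoryTheory Limits MonoidalCategory CartesianMonoidalCategory AlgebraicGeometry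

noncomputable section

namespace Literature.AlgebraicGeometry.GroupSchemes

open scoped MonObj Obj

/-! ### §1 `Ψ` under a monoidal functor of slice categories -/

namespace ActionBaseChange

section Functor

variable {S S' : Scheme.{u}} (F : Over S ⥤ Over S') [F.Monoidal] (G X : Over S) [GrpObj G]
  [σ : ModObj G X]

/-- **`Ψ` commutes with base change**: `μ_F ≫ F(Ψ_{G,X}) = Ψ_{F G, F X} ≫ μ_F` for the transported
action `actionObj F G X`. [cite: MumfordFogartyKirwan1994, Ch. 0 §4, Prop. 0.9, proof (p. 16)] -/
theorem μ_comp_map_shear :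
    Functor.LaxMonoidal.μ F G X ≫ F.map (shear G X) =
      shear (F.obj G) (F.obj X) (σ := actionObj F G X) ≫ Functor.LaxMonoidal.μ F X X := by
  letI := actionObj F G X
  rw [shear, shear, ← Functor.Monoidal.lift_μ, comp_lift_assoc, Functor.Monoidal.μ_snd, ← smul_def]

/-- `Ψ_{F G, F X} = μ_F ≫ F(Ψ_{G,X}) ≫ μ_F⁻¹`. [cite: MumfordFogartyKirwan1994, Ch. 0 §4, Prop. 0.9, proof (p. 16)] -/
theorem shear_obj_eq :
    shear (F.obj G) (F.obj X) (σ := actionObj F G X) =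
      (Functor.Monoidal.μIso F G X).hom ≫ F.map (shear G X) ≫ (Functor.Monoidal.μIso F X X).inv := by
  rw [Functor.Monoidal.μIso_hom, ← Category.assoc, μ_comp_map_shear, Category.assoc,
    Functor.Monoidal.μIso_inv, Functor.Monoidal.μ_δ, Category.comp_id]

/-- On underlying schemes: `(Ψ_{F G, F X}).left = μ.left ≫ (F Ψ).left ≫ μ⁻¹.left`.
[cite: MumfordFogartyKirwan1994, Ch. 0 §4, Prop. 0.9, proof (p. 16)] -/
theorem shear_obj_left :
    (shear (F.obj G) (F.obj X) (σ := actionObj F G X)).left =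
      (Functor.Monoidal.μIso F G X).hom.left ≫ (F.map (shear G X)).left ≫
        (Functor.Monoidal.μIso F X X).inv.left := by
  rw [shear_obj_eq, Over.comp_left, Over.comp_left]

/-- **`Ψ_{F G, F X}` and `F(Ψ)` share every iso-invariant property of scheme morphisms.**
[cite: MumfordFogartyKirwan1994, Ch. 0 §4, Prop. 0.9, proof (p. 16)] -/
theorem shear_obj_left_iff (P : MorphismProperty Scheme.{u}) [P.RespectsIso] :
    P (shear (F.obj G) (F.obj X) (σ := actionObj F G X)).left ↔ P (F.map (shear G X)).left := by
  rw [shear_obj_left, P.cancel_left_of_respectsIso, P.cancel_right_of_respectsIso]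

end Functor

/-! ### §2 Base change `g : S' ⟶ S` -/

section Schemes

variable {S S' : Scheme.{u}} (g : S' ⟶ S) (G X : Over S) [GrpObj G] [σ : ModObj G X]

/-- **Every base-change-stable property passes from `Ψ_{G,X}` to `Ψ_{G ×_S S', X ×_S S'}`.**
[cite: MumfordFogartyKirwan1994, Ch. 0 §4, Prop. 0.9, proof (p. 16)] -/
theorem shear_left_baseChange (P : MorphismProperty Scheme.{u}) [P.IsStableUnderBaseChange]
    (h : P (shear G X).left) :
    P (shear ((Over.pullback g).obj G) ((Over.pullback g).obj X)
      (σ := actionObj (Over.pullback g) G X)).left := by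
  exact (shear_obj_left_iff (Over.pullback g) G X P).mpr
    (P.of_isPullback (Limits.isPullback_pullback_map_left g (shear G X)).flip h)

end Schemes

end ActionBaseChange

section Schemes

variable {S S' : Scheme.{u}} (g : S' ⟶ S) {G X : Over S} [GrpObj G] [σ : ModObj G X]

/-- **A proper action stays proper after base change** (MFK Def. 0.8 (iii)).
[cite: MumfordFogartyKirwan1994, Ch. 0 §4, Prop. 0.9, proof (p. 16)] -/
theorem IsProperAction.baseChange (h : IsProperAction G X) :
    IsProperAction ((Over.pullback g).obj G) ((Over.pullback g).obj X)
      (σ := ActionBaseChange.actionObj (Over.pullback g) G X) :=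
  ActionBaseChange.shear_left_baseChange g G X @IsProper h

/-- **A free action stays free after base change** ("by such a base extension `σ` remains free",
MFK Def. 0.8 (iv)). [cite: MumfordFogartyKirwan1994, Ch. 0 §4, Prop. 0.9, proof (p. 16)] -/
theorem IsFreeAction.baseChange (h : IsFreeAction G X) :
    IsFreeAction ((Over.pullback g).obj G) ((Over.pullback g).obj X)
      (σ := ActionBaseChange.actionObj (Over.pullback g) G X) :=
  ActionBaseChange.shear_left_baseChange g G X @IsClosedImmersion h

end Schemes

/-! ### §3 The proper-monomorphism criterion for freeness -/

section Criterion

variable {S : Scheme.{u}} {G X : Over S} [GrpObj G] [σ : ModObj G X]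

/-- **`Ψ` is a monomorphism of `S`-schemes iff all stabilisers of `T`-valued points are trivial.**
[cite: MumfordFogartyKirwan1994, Ch. 0 §3, Def. 0.8 (iv) (pp. 9–10)] -/
theorem mono_shear_iff_forall_eq_one :
    Mono (shear G X) ↔ ∀ (T : Over S) (a : T ⟶ G) (x : T ⟶ X), a • x = x → a = 1 := by
  constructor
  · intro hm T a x hx
    have h1 : lift a x ≫ shear G X = lift (1 : T ⟶ G) x ≫ shear G X := by
      rw [lift_comp_shear, lift_comp_shear, hx, one_smul]
    have h2 : lift a x = lift (1 : T ⟶ G) x := (cancel_mono _).mp h1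
    simpa using congrArg (· ≫ fst G X) h2
  · intro H
    refine ⟨fun {T} a b e => ?_⟩
    have ha : a = lift (a ≫ fst G X) (a ≫ snd G X) := by
      apply CartesianMonoidalCategory.hom_ext <;> simp
    have hb : b = lift (b ≫ fst G X) (b ≫ snd G X) := by
      apply CartesianMonoidalCategory.hom_ext <;> simp
    rw [ha, hb] at e ⊢
    obtain ⟨h1, h2⟩ := (lift_comp_shear_injective_iff.mpr (H T)) _ _ _ _ e
    rw [h1, h2]

/-- `Ψ.left` is a monomorphism of schemes iff `Ψ` is a monomorphism of `S`-schemes.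
[cite: MumfordFogartyKirwan1994, Ch. 0 §3, Def. 0.8 (iv) (pp. 9–10)] -/
theorem mono_shear_left_iff : Mono (shear G X).left ↔ Mono (shear G X) :=
  ⟨fun _ => Over.mono_of_mono_left _, fun _ => inferInstance⟩

/-- **MFK's working criterion**: an action is free iff it is proper and all stabilisers of
`T`-valued points are trivial (a proper monomorphism is a closed immersion, Stacks 04XV).
[cite: StacksProject, Tag 04XV] -/
theorem isFreeAction_iff_isProperAction_and_forall_eq_one :
    IsFreeAction G X ↔
      IsProperAction G X ∧ ∀ (T : Over S) (a : T ⟶ G) (x : T ⟶ X), a • x = x → a = 1 := by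
  rw [isFreeAction_iff, isProperAction_iff, IsClosedImmersion.iff_isProper_and_mono,
    mono_shear_left_iff, mono_shear_iff_forall_eq_one]

/-- **Proper + trivial stabilisers ⟹ free.** [cite: StacksProject, Tag 04XV] -/
theorem IsFreeAction.of_isProperAction (hp : IsProperAction G X)
    (hfree : ∀ (T : Over S) (a : T ⟶ G) (x : T ⟶ X), a • x = x → a = 1) : IsFreeAction G X :=
  isFreeAction_iff_isProperAction_and_forall_eq_one.mpr ⟨hp, hfree⟩

/-- A free action has `Ψ` a monomorphism and trivial stabilisers (the tree's
`IsFreeAction.eq_one_of_smul_eq`, repackaged). [cite: MumfordFogartyKirwan1994, Ch. 0 §3, Def. 0.8 (iv) (pp. 9–10)] -/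
theorem IsFreeAction.forall_eq_one (h : IsFreeAction G X) :
    ∀ (T : Over S) (a : T ⟶ G) (x : T ⟶ X), a • x = x → a = 1 :=
  fun _ _ _ hx => h.eq_one_of_smul_eq hx

end Criterion

end Literature.AlgebraicGeometry.GroupSchemes
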